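import Literature.Algebra.EuclideanLattices.UniqueSVPBasisVector
import Literature.Algebra.EuclideanLattices.RegevUniqueSVP
import HarnessLib

/-!
# The LLL front end of the classical `GapSVP` reductions: trivial cases and the normalisation window

Topic `Algebra/EuclideanLattices` (family `pqc`). Proved material (no named fact is introduced)
towards the named fact
`Literature.Computability.Cryptography.blprs_gapSVP_sqrt_dim_to_lwe_classical` (**pqc.S21**;
Brakerski–Langlois–Peikert–Regev–Stehlé, STOC 2013, Thm. 1.1), whose first step is the classical
clause of BLPRS Thm. 2.16 ("if in addition `q ≥ 2^{n/2}` then there is also a classical reduction"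
from `GapSVP` to `LWE`), i.e. Peikert's reduction (STOC 2009, Thm. 3.1) from the promise problem
`GapSVP_{ζ,γ}` preceded by LLL. Peikert, §2 ("Computational problems"), remark after the
definition of `GapSVP_{ζ,γ}`: *"For any `ζ(n) ≥ 2^{n/2}`, `GapSVP_{ζ,γ}` is equivalent to the
standard `GapSVP_γ` problem, because an arbitrary basis `B` of `Λ` can be reduced in polynomial
time using the LLL algorithm to another basis `B'` of `Λ` so that
`λ₁(Λ) ≤ ‖b'₁‖ ≤ 2^{n/2} · minᵢ ‖b̃'ᵢ‖`"*, and *"the last condition `1 ≤ d ≤ ζ(n)/γ(n)` is without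
loss of generality, because the instance is trivially solvable when `d` lies outside that range"*.

This file proves that remark in the tree's setting of INTEGER bases (`LatticeInstance`,
`GapSVP.yes/no` of `Problems.lean`), where a basis cannot be rescaled to `minᵢ ‖b̃ᵢ‖ = 1`; the
normalisation is therefore stated SCALE-FREE, as a lower bound on the Gram–Schmidt norms relative
to the threshold `d` (the form consumed by the scale-free admissibility lemma
`Peikert2009.bddAdmissible_of_le_minNorm` of `Cryptography/PeikertReduction.lean`, hypothesis
`∀ i, s ≤ ‖b̃ᵢ‖`). For a nonsingular instance `(B, d)` of dimension `n ≥ 1` whose rows are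
LLL-reduced with `δ = 3/4` (indices from `0`, first row `b₀`):

* `not_mem_gapSVP_no_of_norm_le`, `not_mem_gapSVP_no_of_norm_vec_le` — **YES is a safe answer when
  `‖b₀‖ ≤ γ(n)·d`** (any nonzero lattice vector of norm `≤ γ d` excludes a NO instance, `λ₁ ≤ ‖b₀‖`);
* `norm_vec_zero_le_sqrt_two_pow_mul_minNorm` — LLL82 Prop. 1.11 in instance form,
  `‖b₀‖ ≤ 2^{(n-1)/2} λ₁(L(B))` (from the tree theorem `norm_zero_sq_le_two_pow_mul_minNorm_sq_holds`);
* `not_mem_gapSVP_yes_of_lt_norm_vec_zero` — **NO is a safe answer when `‖b₀‖ > 2^{(n-1)/2}·d`**;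
* `norm_vec_zero_le_sqrt_two_pow_mul_norm_gramSchmidt` — LLL82 (1.7) with `j = 0`:
  `‖b₀‖ ≤ 2^{(n-1)/2} ‖b̃ᵢ‖` for every `i` (from `sq_norm_zero_le_two_pow_mul_holds`), i.e. Peikert's
  `‖b₁‖ ≤ 2^{n/2} minᵢ‖b̃ᵢ‖` with the sharper constant of LLL82;
* `lt_norm_gramSchmidt_of_lt_norm_vec_zero` — **the window is normalised**: if `γ(n)·d < ‖b₀‖` then
  `γ(n)·d / 2^{(n-1)/2} < ‖b̃ᵢ‖` for every `i`;
* `gapSVP_lll_trichotomy` — the three cases together: on an LLL-reduced nonsingular instance either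
  YES is safe, or NO is safe, or `γ d < ‖b₀‖ ≤ 2^{(n-1)/2} d` and all Gram–Schmidt norms exceed
  `γ d / 2^{(n-1)/2}` (the only case in which the `LWE` oracle is consulted; it forces
  `γ(n) < 2^{(n-1)/2}` and plays the role of Peikert's promise `minᵢ‖b̃ᵢ‖ ≥ 1`, `d ≤ ζ/γ` with
  `ζ = 2^{(n-1)/2}` at scale `γ d/2^{(n-1)/2}`);
* transport along `L(B') = L(B)`: `mem_gapSVP_yes_iff_of_lattice_eq`, `mem_gapSVP_no_iff_of_lattice_eq`
  (membership in `GapSVP.yes/no` depends on the instance only through its dimension and lattice), and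
  `exists_lllMachineF_gapSVP` — the polynomial-time LLL string function `LLLMachine.lllMachineF` of the
  tree (LLL82 Prop. 1.26, `exists_lllMachineF_encode_eq`) maps the code of a nonsingular `B` to the
  code of an LLL-reduced `B'` of the same dimension with `((B', d) ∈ yes ↔ (B, d) ∈ yes)` and
  `((B', d) ∈ no ↔ (B, d) ∈ no)` for every threshold `d`.

Exponent convention: `2^{(n-1)/2}` is written `Real.sqrt 2 ^ (I.n - 1)` under the hypothesis
`I.n ≠ 0` (honest predecessor), as in `UniqueSVPBasisVector.lean`.

## What is NOT here

The probabilistic polynomial-time oracle machine realising the front end (parse, run `lllMachineF`,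
compare `‖b₀‖²` with `γ² d²` and `2^{n-1} d²`, dispatch) and Peikert's reduction itself
(`Cryptography/PeikertReduction.lean`); this file is the lattice geometry they rest on.

## References

* C. Peikert, *Public-key cryptosystems from the worst-case shortest vector problem*, STOC 2009,
  333–342, §2 (definitions of `GapSVP_γ`, `GapSVP_{ζ,γ}` and the remark following them), Thm. 3.1.
* Z. Brakerski, A. Langlois, C. Peikert, O. Regev, D. Stehlé, *Classical hardness of learning with
  errors*, STOC 2013, Thm. 2.16 (arXiv:1306.0281, §2.3 "Relation to lattice problems").
* A. K. Lenstra, H. W. Lenstra Jr., L. Lovász, *Factoring polynomials with rational coefficients*,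
  Math. Ann. 261 (1982), Prop. 1.6 (1.7), Prop. 1.11, Prop. 1.26.
-/

noncomputable section

open Module InnerProductSpace

namespace Literature.Algebra.EuclideanLattices

/-! ### `GapSVP` membership is a property of the dimension and the lattice -/

/-- Two integer bases of the same dimension generating the same lattice are nonsingular together
(both directions of `LatticeInstance.isNonsingular_of_lattice_eq`). [folklore] -/
theorem LatticeInstance.isNonsingular_iff_of_lattice_eq {I : LatticeInstance}
    {B' : Matrix (Fin I.n) (Fin I.n) ℤ} (h : (⟨I.n, B'⟩ : LatticeInstance).lattice = I.lattice) :
    (⟨I.n, B'⟩ : LatticeInstance).IsNonsingular ↔ I.IsNonsingular := by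
  refine ⟨fun h' => ?_, fun hI => LatticeInstance.isNonsingular_of_lattice_eq hI h⟩
  exact LatticeInstance.isNonsingular_of_lattice_eq (I := ⟨I.n, B'⟩) (B' := I.basis) h' h.symm

/-- Membership in `GapSVP.yes γ` depends on the instance only through its dimension and its lattice
(the YES set is `det B ≠ 0 ∧ 0 < d ∧ λ₁(L(B)) ≤ d`). [cite: Peikert2009, §2 (definition of GapSVP_γ)] -/
theorem mem_gapSVP_yes_iff_of_lattice_eq {γ : ℕ → ℝ} {I : LatticeInstance}
    {B' : Matrix (Fin I.n) (Fin I.n) ℤ} (h : (⟨I.n, B'⟩ : LatticeInstance).lattice = I.lattice)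
    (d : ℚ) : ((⟨I.n, B'⟩ : LatticeInstance), d) ∈ GapSVP.yes γ ↔ (I, d) ∈ GapSVP.yes γ := by
  change (⟨I.n, B'⟩ : LatticeInstance).IsNonsingular ∧ 0 < d ∧
      minNorm (⟨I.n, B'⟩ : LatticeInstance).lattice ≤ (d : ℝ) ↔
    I.IsNonsingular ∧ 0 < d ∧ minNorm I.lattice ≤ (d : ℝ)
  rw [LatticeInstance.isNonsingular_iff_of_lattice_eq h, h]

/-- Membership in `GapSVP.no γ` depends on the instance only through its dimension and its lattice
(the NO set is `det B ≠ 0 ∧ 0 < d ∧ γ(n) d < λ₁(L(B))`). [cite: Peikert2009, §2 (definition of GapSVP_γ)] -/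
theorem mem_gapSVP_no_iff_of_lattice_eq {γ : ℕ → ℝ} {I : LatticeInstance}
    {B' : Matrix (Fin I.n) (Fin I.n) ℤ} (h : (⟨I.n, B'⟩ : LatticeInstance).lattice = I.lattice)
    (d : ℚ) : ((⟨I.n, B'⟩ : LatticeInstance), d) ∈ GapSVP.no γ ↔ (I, d) ∈ GapSVP.no γ := by
  change (⟨I.n, B'⟩ : LatticeInstance).IsNonsingular ∧ 0 < d ∧
      γ I.n * (d : ℝ) < minNorm (⟨I.n, B'⟩ : LatticeInstance).lattice ↔
    I.IsNonsingular ∧ 0 < d ∧ γ I.n * (d : ℝ) < minNorm I.lattice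
  rw [LatticeInstance.isNonsingular_iff_of_lattice_eq h, h]

/-! ### First trivial case: a short basis vector certifies "not NO" -/

/-- **YES is a safe answer once a lattice vector of norm `≤ γ(n)·d` is known**: if some nonzero
`v ∈ L(B)` has `‖v‖ ≤ γ(n) d` then `(B, d)` is not a NO instance of `GapSVP_γ` (`λ₁ ≤ ‖v‖ ≤ γ d`,
whereas NO means `γ d < λ₁`). This is the half of Peikert's remark "the instance is trivially
solvable when `d` lies outside that range" concerning large `d`. [cite: Peikert2009, §2 (remark after the definition of GapSVP_{ζ,γ})] -/
theorem not_mem_gapSVP_no_of_norm_le {γ : ℕ → ℝ} {I : LatticeInstance} {d : ℚ}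
    {v : EuclideanSpace ℝ (Fin I.n)} (hv : v ∈ I.lattice) (hv0 : v ≠ 0)
    (hle : ‖v‖ ≤ γ I.n * d) : (I, d) ∉ GapSVP.no γ := by
  rintro ⟨-, -, hno⟩
  have hmin : minNorm I.lattice ≤ ‖v‖ :=
    csInf_le ⟨0, by rintro _ ⟨y, -, rfl⟩; exact norm_nonneg y⟩ ⟨v, ⟨hv, hv0⟩, rfl⟩
  exact absurd (lt_of_lt_of_le hno (hmin.trans hle)) (lt_irrefl _)

/-- **YES is a safe answer when `‖bᵢ‖ ≤ γ(n)·d`** for some row `bᵢ` of a nonsingular integer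
basis (a row is a nonzero lattice vector). [cite: Peikert2009, §2 (remark after the definition of GapSVP_{ζ,γ})] -/
theorem not_mem_gapSVP_no_of_norm_vec_le {γ : ℕ → ℝ} {I : LatticeInstance} (hI : I.IsNonsingular)
    {d : ℚ} (i : Fin I.n) (hle : ‖I.vec i‖ ≤ γ I.n * d) : (I, d) ∉ GapSVP.no γ :=
  not_mem_gapSVP_no_of_norm_le (Submodule.subset_span ⟨i, rfl⟩)
    ((LatticeInstance.linearIndependent_vec hI).ne_zero i) hle

/-! ### Second trivial case: a long first LLL vector certifies "not YES" -/

/-- `(√2)^{2k} = 2^k`. [folklore] -/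
theorem sqrt_two_pow_sq (k : ℕ) : (Real.sqrt 2 ^ k) ^ 2 = 2 ^ k := by
  rw [← pow_mul, mul_comm, pow_mul, Real.sq_sqrt (by norm_num : (0 : ℝ) ≤ 2)]

/-- **LLL82 Prop. 1.11 for a lattice instance**: if the rows of a nonsingular integer basis of
dimension `n ≥ 1` are LLL-reduced with `δ = 3/4`, then `‖b₀‖ ≤ 2^{(n-1)/2} λ₁(L(B))` — the
tree theorem `IsLLLReduced.norm_zero_sq_le_two_pow_mul_minNorm_sq_holds` (`‖b₀‖² ≤ 2^{n-1} λ₁²`)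
for the real basis of rows, square-rooted. This is the inequality `λ₁(Λ) ≤ ‖b₁‖ ≤ 2^{n/2}·(…)`
of Peikert's remark, with LLL82's constant. [cite: LenstraLenstraLovasz1982, Prop. 1.11] -/
theorem norm_vec_zero_le_sqrt_two_pow_mul_minNorm {I : LatticeInstance} (hI : I.IsNonsingular)
    (hn : I.n ≠ 0) (hred : IsLLLReduced (3 / 4) I.vec) :
    ‖I.vec ⟨0, Nat.pos_of_ne_zero hn⟩‖ ≤ Real.sqrt 2 ^ (I.n - 1) * minNorm I.lattice := by
  have h11 := IsLLLReduced.norm_zero_sq_le_two_pow_mul_minNorm_sq_holds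
    (LatticeInstance.basisOfIsNonsingular hI)
    (by rw [LatticeInstance.coe_basisOfIsNonsingular]; exact hred) hn
  dsimp only [Literature.Computability.Cryptography.latticeOfBasis] at h11
  rw [← LatticeInstance.lattice_eq_span_basisOfIsNonsingular hI,
    LatticeInstance.coe_basisOfIsNonsingular] at h11
  have h2 : ‖I.vec ⟨0, Nat.pos_of_ne_zero hn⟩‖ ^ 2 ≤
      (Real.sqrt 2 ^ (I.n - 1) * minNorm I.lattice) ^ 2 := by
    rw [mul_pow, sqrt_two_pow_sq]
    exact h11
  exact (pow_le_pow_iff_left₀ (norm_nonneg _)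
    (mul_nonneg (by positivity) (minNorm_nonneg _)) two_ne_zero).1 h2

/-- **NO is a safe answer when `‖b₀‖ > 2^{(n-1)/2}·d`**: for a nonsingular integer basis of
dimension `n ≥ 1` with LLL-reduced rows (`δ = 3/4`), if `2^{(n-1)/2} d < ‖b₀‖` then `(B, d)` is not
a YES instance of `GapSVP_γ` (YES means `λ₁ ≤ d`, but `‖b₀‖ ≤ 2^{(n-1)/2} λ₁`). This is the other
half of "trivially solvable when `d` lies outside that range" (small `d`), made effective by LLL
exactly as in Peikert's remark. [cite: Peikert2009, §2 (remark after the definition of GapSVP_{ζ,γ})] -/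
theorem not_mem_gapSVP_yes_of_lt_norm_vec_zero {γ : ℕ → ℝ} {I : LatticeInstance} (hn : I.n ≠ 0)
    (hred : IsLLLReduced (3 / 4) I.vec) {d : ℚ}
    (hlt : Real.sqrt 2 ^ (I.n - 1) * (d : ℝ) < ‖I.vec ⟨0, Nat.pos_of_ne_zero hn⟩‖) :
    (I, d) ∉ GapSVP.yes γ := by
  rintro ⟨hI, -, hyes⟩
  have h := norm_vec_zero_le_sqrt_two_pow_mul_minNorm hI hn hred
  have h' : Real.sqrt 2 ^ (I.n - 1) * minNorm I.lattice ≤ Real.sqrt 2 ^ (I.n - 1) * (d : ℝ) :=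
    mul_le_mul_of_nonneg_left hyes (by positivity)
  exact absurd (lt_of_lt_of_le hlt (h.trans h')) (lt_irrefl _)

/-! ### The window: Gram–Schmidt norms are bounded below at the scale of `d` -/

/-- **LLL82 (1.7) with `j = 0`, instance form**: for LLL-reduced rows (`δ = 3/4`) of dimension
`n ≥ 1`, `‖b₀‖ ≤ 2^{(n-1)/2} ‖b̃ᵢ‖` for EVERY `i` — from the tree theorem
`IsLLLReduced.sq_norm_zero_le_two_pow_mul_holds` (`‖b₀‖² ≤ 2^i ‖b̃ᵢ‖²`) and `2^i ≤ 2^{n-1}`. Hence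
`‖b₀‖ ≤ 2^{(n-1)/2} minᵢ ‖b̃ᵢ‖`, Peikert's "`‖b₁‖ ≤ 2^{n/2} · minᵢ ‖b̃ᵢ‖`" (indices from `1` there).
No nonsingularity is needed. [cite: LenstraLenstraLovasz1982, Prop. 1.6 (1.7)] -/
theorem norm_vec_zero_le_sqrt_two_pow_mul_norm_gramSchmidt {I : LatticeInstance} (hn : I.n ≠ 0)
    (hred : IsLLLReduced (3 / 4) I.vec) (i : Fin I.n) :
    ‖I.vec ⟨0, Nat.pos_of_ne_zero hn⟩‖ ≤ Real.sqrt 2 ^ (I.n - 1) * ‖gramSchmidt ℝ I.vec i‖ := by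
  have h := IsLLLReduced.sq_norm_zero_le_two_pow_mul_holds hred i (Nat.pos_of_ne_zero hn)
  have hi : (2 : ℝ) ^ (i : ℕ) ≤ 2 ^ (I.n - 1) := pow_le_pow_right₀ one_le_two (by omega)
  have h2 : ‖I.vec ⟨0, Nat.pos_of_ne_zero hn⟩‖ ^ 2 ≤
      (Real.sqrt 2 ^ (I.n - 1) * ‖gramSchmidt ℝ I.vec i‖) ^ 2 := by
    rw [mul_pow, sqrt_two_pow_sq]
    exact h.trans (mul_le_mul_of_nonneg_right hi (sq_nonneg _))
  exact (pow_le_pow_iff_left₀ (norm_nonneg _) (by positivity) two_ne_zero).1 h2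

/-- **The window is normalised (scale-free form of Peikert's promise `minᵢ ‖b̃ᵢ‖ ≥ 1`,
`d ≤ ζ/γ`, `ζ = 2^{(n-1)/2}`)**: for LLL-reduced rows of dimension `n ≥ 1`, if `γ(n)·d < ‖b₀‖`
then every Gram–Schmidt norm exceeds `γ(n)·d / 2^{(n-1)/2}`. At scale `s = γ d/2^{(n-1)/2}` this
reads `minᵢ ‖b̃ᵢ‖ ≥ s` and `d ≤ (2^{(n-1)/2} s)/γ`, the two normalisation conditions of
`GapSVP_{ζ,γ}` used by the reduction of Peikert's Thm. 3.1. [cite: Peikert2009, §2 (remark after the definition of GapSVP_{ζ,γ})] -/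
theorem lt_norm_gramSchmidt_of_lt_norm_vec_zero {γ : ℕ → ℝ} {I : LatticeInstance} (hn : I.n ≠ 0)
    (hred : IsLLLReduced (3 / 4) I.vec) {d : ℚ}
    (hlt : γ I.n * (d : ℝ) < ‖I.vec ⟨0, Nat.pos_of_ne_zero hn⟩‖) (i : Fin I.n) :
    γ I.n * (d : ℝ) / Real.sqrt 2 ^ (I.n - 1) < ‖gramSchmidt ℝ I.vec i‖ := by
  have hpos : (0 : ℝ) < Real.sqrt 2 ^ (I.n - 1) := by positivity
  rw [div_lt_iff₀ hpos]
  exact lt_of_lt_of_le hlt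
    ((norm_vec_zero_le_sqrt_two_pow_mul_norm_gramSchmidt hn hred i).trans_eq (mul_comm _ _))

/-! ### The three cases together -/

/-- **The LLL front end of the classical `GapSVP_γ` reductions** (Peikert 2009, §2, remark after the
definition of `GapSVP_{ζ,γ}`; used as BLPRS 2013, Thm. 2.16, classical clause). Let `B` be a
nonsingular integer basis of dimension `n ≥ 1` whose rows are LLL-reduced with `δ = 3/4`, `γ` an
approximation factor and `d` a threshold. Then one of three cases holds: (1) `‖b₀‖ ≤ γ(n) d` and
`(B, d)` is not a NO instance of `GapSVP_γ` (answer YES); (2) `‖b₀‖ > 2^{(n-1)/2} d` and `(B, d)` is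
not a YES instance (answer NO); (3) `γ(n) d < ‖b₀‖ ≤ 2^{(n-1)/2} d` — possible only when
`γ(n) < 2^{(n-1)/2}` — and all Gram–Schmidt norms exceed `γ(n) d/2^{(n-1)/2}`, the normalised window
on which the `LWE`-based decision procedure is run. [cite: Peikert2009, §2 (remark after the definition of GapSVP_{ζ,γ})] -/
theorem gapSVP_lll_trichotomy (γ : ℕ → ℝ) {I : LatticeInstance} (hI : I.IsNonsingular)
    (hn : I.n ≠ 0) (hred : IsLLLReduced (3 / 4) I.vec) (d : ℚ) :
    (‖I.vec ⟨0, Nat.pos_of_ne_zero hn⟩‖ ≤ γ I.n * d ∧ (I, d) ∉ GapSVP.no γ) ∨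
    (Real.sqrt 2 ^ (I.n - 1) * (d : ℝ) < ‖I.vec ⟨0, Nat.pos_of_ne_zero hn⟩‖ ∧
      (I, d) ∉ GapSVP.yes γ) ∨
    (γ I.n * (d : ℝ) < ‖I.vec ⟨0, Nat.pos_of_ne_zero hn⟩‖ ∧
      ‖I.vec ⟨0, Nat.pos_of_ne_zero hn⟩‖ ≤ Real.sqrt 2 ^ (I.n - 1) * (d : ℝ) ∧
      ∀ i, γ I.n * (d : ℝ) / Real.sqrt 2 ^ (I.n - 1) < ‖gramSchmidt ℝ I.vec i‖) := by
  by_cases h1 : ‖I.vec ⟨0, Nat.pos_of_ne_zero hn⟩‖ ≤ γ I.n * d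
  · exact Or.inl ⟨h1, not_mem_gapSVP_no_of_norm_vec_le hI _ h1⟩
  by_cases h2 : Real.sqrt 2 ^ (I.n - 1) * (d : ℝ) < ‖I.vec ⟨0, Nat.pos_of_ne_zero hn⟩‖
  · exact Or.inr (Or.inl ⟨h2, not_mem_gapSVP_yes_of_lt_norm_vec_zero hn hred h2⟩)
  exact Or.inr (Or.inr ⟨lt_of_not_ge h1, le_of_not_gt h2,
    lt_norm_gramSchmidt_of_lt_norm_vec_zero hn hred (lt_of_not_ge h1)⟩)

/-! ### The reduced basis is supplied by the polynomial-time LLL machine of the tree -/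

/-- **LLL82 Prop. 1.26 in the form consumed by the `GapSVP` front end**: the polynomial-time string
function `LLLMachine.lllMachineF` maps the code of a nonsingular integer basis `B` of dimension `n`
to the code of an integer basis `B'` of dimension `n` whose rows are LLL-reduced with `δ = 3/4` and
such that, for every threshold `d` and factor `γ`, `(B', d)` and `(B, d)` are YES instances of
`GapSVP_γ` together and NO instances together (`L(B') = L(B)`; `exists_lllMachineF_encode_eq` with
the transport lemmas above). Peikert: "an arbitrary basis `B` of `Λ` can be reduced in polynomial
time using the LLL algorithm to another basis `B'` of `Λ`". [cite: LenstraLenstraLovasz1982, Prop. 1.26] -/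
theorem exists_lllMachineF_gapSVP {I : LatticeInstance} (hI : I.IsNonsingular) :
    ∃ B' : Matrix (Fin I.n) (Fin I.n) ℤ,
      LLLMachine.lllMachineF I.encode = (⟨I.n, B'⟩ : LatticeInstance).encode ∧
      (⟨I.n, B'⟩ : LatticeInstance).IsNonsingular ∧
      IsLLLReduced (3 / 4) (⟨I.n, B'⟩ : LatticeInstance).vec ∧
      ∀ (γ : ℕ → ℝ) (d : ℚ),
        (((⟨I.n, B'⟩ : LatticeInstance), d) ∈ GapSVP.yes γ ↔ (I, d) ∈ GapSVP.yes γ) ∧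
        (((⟨I.n, B'⟩ : LatticeInstance), d) ∈ GapSVP.no γ ↔ (I, d) ∈ GapSVP.no γ) := by
  obtain ⟨B', hcode, hlat, hred⟩ := exists_lllMachineF_encode_eq hI
  exact ⟨B', hcode, LatticeInstance.isNonsingular_of_lattice_eq hI hlat, hred, fun γ d =>
    ⟨mem_gapSVP_yes_iff_of_lattice_eq hlat d, mem_gapSVP_no_iff_of_lattice_eq hlat d⟩⟩

end Literature.Algebra.EuclideanLattices

end
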